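import Literature.AlgebraicGeometry.HodgeTheory.ExteriorPullback
import Literature.AlgebraicGeometry.HodgeTheory.WeilClassesSplitSquare
import Literature.AlgebraicGeometry.HodgeTheory.WeilPlaneFibreCharts
import Literature.AlgebraicGeometry.HodgeTheory.ChernCharacterBetti
import Literature.AlgebraicGeometry.HodgeTheory.DiagonalSymmetryStability
import Literature.Barriers.HodgeConjecture.ExceptionalHodgeClasses
import HarnessLib

/-!
# The Weil classes of a square are a DIVISOR POLYNOMIAL: `E_± = ℂ · (R ± i√d·S)^{⌣g}`

Family `hodge`, layer `Literature/AlgebraicGeometry/HodgeTheory`. Fact-free sequel of `WeilClassesSplitSquare`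
(Deligne's split square `(T × T, Φ_d)`, `Φ_d(x,y) = (-d·y, x)`) and `WeilClassesTwistedSquare` (`(T × T, φ × (-φ))`),
answering the B2b ladder's request (`run/shared/lean/b2b/hodge-weil/LADDER.md ## CARVER v5` C33 (c1)/(c2), C36 (i),
`## CARVER v6` C40 row pv3): at these points of the Weil-type moduli the two Weil lines are spanned by the `g`-th cup
power of ONE explicit degree-`2` class, a `ℚ(i√d)`-combination of THREE pull-backs of any class `θ ∈ H²(T)` with
`θ^{⌣g} ≠ 0` (e.g. a polarization) along homomorphisms `T × T → T`.

## The mechanism (one abstract theorem, `cupPowTwo_weilGenerator_mem_and_ne_zero`)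

Let `A`, `T` be complex abelian varieties, `dim T = g ≥ 1`, `dim A = 2g`, `Φ : A ⟶ A` with `Φ ≫ Φ = -d` (`d ≥ 1`),
and `q₁, q₂ : A ⟶ T` homomorphisms INTERTWINING `Φ` with `Φ_d`:  `Φ ≫ q₂ = q₁`, `Φ ≫ q₁ = -d·q₂`.  For `c ∈ ℂ` with
`c² = -d` the "virtual homomorphism" `q₁ + c·q₂ ∈ Hom(A, T) ⊗ ℂ` acts on `H¹` by `L_c = q₁^* + c·q₂^*`, whose image
lies in the `c`-eigenspace of `Φ^*` (`Φ^* L_c = (Φ ≫ q₁)^* + c(Φ ≫ q₂)^* = -d·q₂^* + c·q₁^* = c·L_c`), and on all of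
`H•(T) = ⋀•H¹(T)` by the exterior pull-back `⋀•L_c` (file `ExteriorPullback`). Hence, if `L_c` is injective:
`⋀^{2g}L_c` maps the top line `H^{2g}(T)` isomorphically onto the Weil line `E_c = ⋀^{2g}(c`-eigenspace`)`, and for ANY
`θ ∈ H²(T)` with `θ^g ≠ 0`,

  `E_c = ℂ · (⋀²L_c θ)^{⌣g}`,  `⋀²L_c θ = q₁^*θ - d·q₂^*θ + c·((q₁+q₂)^*θ - q₁^*θ - q₂^*θ) =: Ω_c(θ)`

(`weilGenerator`; the degree-`2` expansion `⋀²(aF + bG)(u ⌣ v) = a²·F(u⌣v) + b²·G(u⌣v) + ab·(Fu ⌣ Gv + Gu ⌣ Fv)` and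
`(q₁+q₂)^* = q₁^* + q₂^*` on `H¹`). With `R = q₁^*θ - d·q₂^*θ`, `S = (q₁+q₂)^*θ - q₁^*θ - q₂^*θ` (RATIONAL divisor classes
when `θ` is): **`W_K ⊗ ℂ = E₊ ⊕ E₋ = ℂ(R + i√d S)^g ⊕ ℂ(R - i√d S)^g ⊆ ℂ[R, S]_g`**, so `W_K = ℚ·Re(R + i√d S)^g ⊕ ℚ·Im(…)/√d`.

## Consequences here; instances in the sequel

* `weilClassesPlus_eq_span_cupPowTwo_weilGenerator`, `weilClassesMinus_…`, `weilClassesOf_…`: `E₊ = ℂ·Ω₊^g`,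
  `E₋ = ℂ·Ω₋^g`, `W_K ⊗ ℂ = span {Ω₊^g, Ω₋^g}` (`Ω_± = Ω_{±i√d}(θ)`).
* NON-EXCEPTIONALITY (`weilClassesOf_le_divisorClassesSpan_of_intertwining`): if `Θ ∈ H²(A)` is a RATIONAL `(1,1)`-class
  (e.g. a polarization) whose restriction `θ = s^*Θ` along some `s : T ⟶ A` has `θ^g ≠ 0`, then every
  `q^*θ = (q ≫ s)^*Θ` is a rational `(1,1)`-class on `A` (pull-back along an ENDOMORPHISM, `IsOfHodgeType.map_endomorphism`,
  unconditional in the tree), so **`W_K ⊗ ℂ ⊆ Dᵍ ⊗ ℂ = divisorClassesSpan A (2g) g`**: such `(A, Φ)` are points where the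
  Weil classes are NOT exceptional — read against the barrier `Literature.Barriers.HodgeConjecture.Weil1977_exceptionalHodgeClasses`
  (`W ⊄ Dⁿ` for the GENERAL member, van Geemen Thm. 4.11).
* The two instances — Deligne's SPLIT square `(T × T, Φ_d)` (`q₁ = p₁`, `q₂ = p₂`: `Ω_c = θ₁ - dθ₂ + c·ω`, `ω` the mixed
  class of `θ`) and the TWISTED square `(T × T, φ × (-φ))` (`q₁ = p₁ ≫ φ - p₂ ≫ φ`, `q₂ = p₁ + p₂`, the `K`-isogeny onto the
  split square) — are the file `WeilClassesSquareDivisorPolynomialSquares`.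

Honest label: Deligne, LNM 900, Lemma 4.5 / Remark 4.10 (`A₀ ⊗ K`: "`cl(λ)` = image of the class of a point"), made into
an explicit divisor polynomial on the real carriers; the ladder's C33 (c1)/(c2) and C36 (i) typed. Nothing here is a rung;
no named fact; the definition `weilGenerator` is an abbreviation of an explicit formula.

## References

* [Deligne1982HodgeCycles] P. Deligne, LNM 900 (1982), §4 Lemma 4.5, Remark 4.10, (4.3)–(4.4).
* [vanGeemen1994HodgeAV] B. van Geemen, LNM 1594 (1994), 4.8–4.11 (Thm. 4.11 = Weil 1977: `Bⁿ ≠ Dⁿ` generically), 5.2, 6.12.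
* [Schoen1998HodgeWeilAddendum] C. Schoen, Compositio Math. 114 (1998), §10.
* [LangeBirkenhake1992] H. Lange, Ch. Birkenhake, Complex Abelian Varieties (1992), 1.1.2, Lemma 1.1.17, §5.
* [Hatcher2002] A. Hatcher, Algebraic Topology (2002), §3.2.
-/

noncomputable section

open CategoryTheory

namespace Literature.AlgebraicGeometry.HodgeTheory

open Literature.AlgebraicTopology.SingularHomology
open Literature.AlgebraicGeometry.Motives
open Literature.Barriers.HodgeConjecture

section HodgeTheory

variable {A T : Motives.AbelianVariety ℂ}

/-! ### Preliminaries on the real carriers -/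

/-- `v₀ ⌣ v₁` as the value of the iterated product `cupPowOne 2`. [cite: Hatcher2002, §3.2] -/
theorem cupPowOne_two {Y : Type} [TopologicalSpace Y] (v : Fin 2 → singularCohomology ℂ ℂ Y 1) :
    cupPowOne ℂ Y 2 v = cupProduct (Nat.add_comm 1 1) (v 0) (v 1) := by
  rw [cupPowOne_succ, cupPowOne_one]
  rfl

/-- **The exterior pull-back of cup powers: `⋀L (xⁱ) = (⋀L x)ⁱ`.** [cite: Hatcher2002, §3.2 Prop. 3.10] -/
theorem exteriorPullback_cupPowTwo {X Y : Type} [TopologicalSpace X] [TopologicalSpace Y]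
    (hX : HasExteriorCohomologyH1 ℂ X) (L : singularCohomology ℂ ℂ X 1 →ₗ[ℂ] singularCohomology ℂ ℂ Y 1)
    (x : singularCohomology ℂ ℂ X 2) (i : ℕ) :
    exteriorPullback hX L (2 * i) (cupPowTwo x i) = cupPowTwo (exteriorPullback hX L 2 x) i := by
  induction i with
  | zero => exact exteriorPullback_one hX L
  | succ i ih => rw [cupPowTwo_succ, cupPowTwo_succ, exteriorPullback_cupProduct, ih]

/-- **The top cohomology of an abelian variety is a line**: for `dim T = g` and `y ≠ 0` in `H^{2g}(T(ℂ); ℂ)`, every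
class is a multiple of `y` (`b_{2g} = (2g choose 2g) = 1`). [cite: LangeBirkenhake1992, Exercise 1.1.6 (8)] -/
theorem exists_smul_eq_of_degree_top {g : ℕ} (hT : T.dim = g) {y : complexBetti T.X (2 * g)} (hy : y ≠ 0)
    (x : complexBetti T.X (2 * g)) : ∃ a : ℂ, a • y = x := by
  haveI := finite_complexBetti_abelianVariety T 1
  have hΛ := AbelianVariety.hasExteriorCohomologyH1_complexPoints T
  have h1 : Module.finrank ℂ (complexBetti T.X (2 * g)) = 1 := by
    have h := hΛ.finrank_eq (2 * g)
    rw [AbelianVariety.finrank_complexBetti_one, hT, Nat.choose_self] at h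
    exact h
  exact (finrank_eq_one_iff_of_nonzero' y hy).1 h1 x

/-- **Degree-two expansion of the exterior pull-back of `a·f^* + b·g^*`** for homomorphisms `f, g : A ⟶ T` of abelian
varieties: `⋀²(a f^* + b g^*) x = a²·f^*x + b²·g^*x + ab·((f + g)^*x - f^*x - g^*x)` on `H²(T(ℂ); ℂ)` — on `u ⌣ v` both sides
are `(a f^*u + b g^*u) ⌣ (a f^*v + b g^*v)`, using `(f+g)^* = f^* + g^*` on `H¹` (`complexBetti_map_add_deg_one`).
[cite: LangeBirkenhake1992, 1.1.2 and Lemma 1.1.17] -/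
theorem exteriorPullback_two_eq_of_eq_smul_add_smul (f g : A ⟶ T) (a b : ℂ)
    {L : complexBetti T.X 1 →ₗ[ℂ] complexBetti A.X 1}
    (hL : ∀ v, L v = a • complexBetti.map f.hom.hom.hom 1 v + b • complexBetti.map g.hom.hom.hom 1 v)
    (x : complexBetti T.X 2) :
    exteriorPullback (AbelianVariety.hasExteriorCohomologyH1_complexPoints T) L 2 x =
      (a ^ 2) • complexBetti.map f.hom.hom.hom 2 x + (b ^ 2) • complexBetti.map g.hom.hom.hom 2 x +
        (a * b) • (complexBetti.map (f + g).hom.hom.hom 2 x - complexBetti.map f.hom.hom.hom 2 x -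
          complexBetti.map g.hom.hom.hom 2 x) := by
  set hΛ := AbelianVariety.hasExteriorCohomologyH1_complexPoints T
  -- both sides are linear in `x`; compare them on `u ⌣ v`
  let Φ₁ : complexBetti T.X 2 →ₗ[ℂ] complexBetti A.X 2 := exteriorPullback hΛ L 2
  let Φ₂ : complexBetti T.X 2 →ₗ[ℂ] complexBetti A.X 2 :=
    (a ^ 2) • (complexBetti.map f.hom.hom.hom 2).hom + (b ^ 2) • (complexBetti.map g.hom.hom.hom 2).hom +
      (a * b) • ((complexBetti.map (f + g).hom.hom.hom 2).hom - (complexBetti.map f.hom.hom.hom 2).hom -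
        (complexBetti.map g.hom.hom.hom 2).hom)
  suffices h : Φ₁ = Φ₂ by
    have := LinearMap.congr_fun h x
    simpa only [Φ₁, Φ₂, LinearMap.add_apply, LinearMap.smul_apply, LinearMap.sub_apply] using this
  refine exteriorPullback_ext hΛ fun v => ?_
  simp only [Φ₁, Φ₂, LinearMap.add_apply, LinearMap.smul_apply, LinearMap.sub_apply, exteriorPullback_cupPowOne]
  change cupPowOne ℂ _ 2 (fun i => L (v i)) =
    (a ^ 2) • complexBetti.map f.hom.hom.hom 2 (cupPowOne ℂ _ 2 v) +
      (b ^ 2) • complexBetti.map g.hom.hom.hom 2 (cupPowOne ℂ _ 2 v) +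
      (a * b) • (complexBetti.map (f + g).hom.hom.hom 2 (cupPowOne ℂ _ 2 v) -
        complexBetti.map f.hom.hom.hom 2 (cupPowOne ℂ _ 2 v) - complexBetti.map g.hom.hom.hom 2 (cupPowOne ℂ _ 2 v))
  rw [complexBetti_map_cupPowOne, complexBetti_map_cupPowOne, complexBetti_map_cupPowOne]
  have e1 : (fun i => complexBetti.map (f + g).hom.hom.hom 1 (v i)) =
      fun i => complexBetti.map f.hom.hom.hom 1 (v i) + complexBetti.map g.hom.hom.hom 1 (v i) :=
    funext fun i => complexBetti_map_add_deg_one f g (v i)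
  have e2 : (fun i => L (v i)) =
      fun i => a • complexBetti.map f.hom.hom.hom 1 (v i) + b • complexBetti.map g.hom.hom.hom 1 (v i) :=
    funext fun i => hL (v i)
  rw [e1, e2]
  simp only [cupPowOne_two, map_add, map_smul, LinearMap.add_apply, LinearMap.smul_apply]
  module

/-! ### The generator -/

/-- **The Weil generator `Ω_c(θ) = q₁^*θ - d·q₂^*θ + c·((q₁ + q₂)^*θ - q₁^*θ - q₂^*θ) ∈ H²(A(ℂ); ℂ)`** attached to two
homomorphisms `q₁, q₂ : A ⟶ T`, an integer `d`, a scalar `c` (intended `c² = -d`) and a class `θ ∈ H²(T(ℂ); ℂ)`: the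
degree-two part `⋀²(q₁^* + c·q₂^*) θ` of the action of the virtual homomorphism `q₁ + c·q₂ ∈ Hom(A,T) ⊗ ℂ` (Deligne's
`A₀ ⊗ E → A₀` defined by a linear form on `E`, LNM 900 Rem. 4.10). A `ℤ[c]`-combination of the three divisor-type classes
`q₁^*θ`, `q₂^*θ`, `(q₁+q₂)^*θ`. [cite: Deligne1982HodgeCycles, §4 Remark 4.10] -/
def weilGenerator (q₁ q₂ : A ⟶ T) (d : ℕ) (c : ℂ) (θ : complexBetti T.X 2) : complexBetti A.X 2 :=
  complexBetti.map q₁.hom.hom.hom 2 θ - (d : ℂ) • complexBetti.map q₂.hom.hom.hom 2 θ +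
    c • (complexBetti.map (q₁ + q₂).hom.hom.hom 2 θ - complexBetti.map q₁.hom.hom.hom 2 θ -
      complexBetti.map q₂.hom.hom.hom 2 θ)

/-- `Ω_c(θ) = ⋀²(q₁^* + c·q₂^*) θ` when `c² = -d`. [cite: Deligne1982HodgeCycles, §4 Remark 4.10] -/
theorem exteriorPullback_two_eq_weilGenerator (q₁ q₂ : A ⟶ T) {d : ℕ} {c : ℂ} (hc : c * c = -(d : ℂ))
    {L : complexBetti T.X 1 →ₗ[ℂ] complexBetti A.X 1}
    (hL : ∀ v, L v = complexBetti.map q₁.hom.hom.hom 1 v + c • complexBetti.map q₂.hom.hom.hom 1 v)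
    (θ : complexBetti T.X 2) :
    exteriorPullback (AbelianVariety.hasExteriorCohomologyH1_complexPoints T) L 2 θ = weilGenerator q₁ q₂ d c θ := by
  rw [exteriorPullback_two_eq_of_eq_smul_add_smul q₁ q₂ 1 c (fun v => by rw [hL, one_smul]) θ, weilGenerator,
    one_pow, one_smul, one_mul, pow_two, hc]
  module

/-! ### The abstract theorem: intertwining pairs `(q₁, q₂)` -/

section Abstract

variable {g d : ℕ} {Φ : A ⟶ A} {q₁ q₂ : A ⟶ T} {c : ℂ}

/-- **`q₁^*v + c·q₂^*v` is a `c`-eigenvector of `Φ^*` on `H¹(A)`** when `Φ ≫ q₂ = q₁`, `Φ ≫ q₁ = -d·q₂` and `c² = -d`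
(`Φ^*(q₁^*v + c q₂^*v) = -d·q₂^*v + c·q₁^*v = c·(q₁^*v + c q₂^*v)`). [cite: Deligne1982HodgeCycles, §4 Lemma 4.5 (proof)] -/
theorem map_add_smul_map_mem_eigenspace_of_intertwining (h₂ : Φ ≫ q₂ = q₁) (h₁ : Φ ≫ q₁ = -(d • q₂))
    (hc : c * c = -(d : ℂ)) (v : complexBetti T.X 1) :
    complexBetti.map q₁.hom.hom.hom 1 v + c • complexBetti.map q₂.hom.hom.hom 1 v ∈
      Module.End.eigenspace (complexBetti.map Φ.hom.hom.hom 1).hom c := by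
  rw [Module.End.mem_eigenspace_iff]
  change complexBetti.map Φ.hom.hom.hom 1 _ = _
  have e1 : complexBetti.map Φ.hom.hom.hom 1 (complexBetti.map q₁.hom.hom.hom 1 v) =
      -((d : ℂ) • complexBetti.map q₂.hom.hom.hom 1 v) := by
    rw [complexBetti_map_map_hom, h₁, complexBetti_map_neg_deg_one, complexBetti_map_nsmul_deg_one,
      Nat.cast_smul_eq_nsmul]
  have e2 : complexBetti.map Φ.hom.hom.hom 1 (complexBetti.map q₂.hom.hom.hom 1 v) =
      complexBetti.map q₁.hom.hom.hom 1 v := by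
    rw [complexBetti_map_map_hom, h₂]
  rw [map_add, map_smul, e1, e2, smul_add, smul_smul, hc, neg_smul, add_comm]

/-- **The abstract square theorem.** Let `dim T = g ≥ 1`, `dim A = 2g`, `Φ ≫ Φ = -d` (`d ≥ 1`), `q₁, q₂ : A ⟶ T` with
`Φ ≫ q₂ = q₁`, `Φ ≫ q₁ = -d·q₂`, `c² = -d`, and suppose `L_c = q₁^* + c·q₂^*` is injective on `H¹(T)`. Then for every
`θ ∈ H²(T(ℂ); ℂ)` with `θ^{⌣g} ≠ 0` the class `Ω_c(θ)^{⌣g}` (`weilGenerator`) is a NON-ZERO element of the Weil line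
`E_c = {x : (a·𝟙 + b·Φ)^* x = (a + bc)^{2g} x}`: it is `⋀^{2g}L_c (θ^g)` (multiplicativity of `⋀•L_c` and the degree-two
expansion), `θ^g` is a multiple of the top product of a basis `e` of `H¹(T)`, `⋀^{2g}L_c` of that product is the product of
the `c`-eigenvectors `L_c eᵢ`, and `⋀^{2g}L_c` is injective. [cite: Deligne1982HodgeCycles, §4 Lemma 4.5 and Remark 4.10]
[cite: vanGeemen1994HodgeAV, proof of Thm. 6.12] -/
theorem cupPowTwo_weilGenerator_mem_and_ne_zero (hT : T.dim = g) (h₂ : Φ ≫ q₂ = q₁)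
    (h₁ : Φ ≫ q₁ = -(d • q₂)) (hc : c * c = -(d : ℂ))
    (hinj : ∀ v : complexBetti T.X 1,
      complexBetti.map q₁.hom.hom.hom 1 v + c • complexBetti.map q₂.hom.hom.hom 1 v = 0 → v = 0)
    {θ : complexBetti T.X 2} (hθ : cupPowTwo θ g ≠ 0) :
    cupPowTwo (weilGenerator q₁ q₂ d c θ) g ∈
        pullbackEigenclasses A Φ (2 * g) (fun x y => ((x : ℂ) + (y : ℂ) * c) ^ (2 * g)) ∧
      cupPowTwo (weilGenerator q₁ q₂ d c θ) g ≠ 0 := by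
  have hΛT := AbelianVariety.hasExteriorCohomologyH1_complexPoints T
  have hΛA := AbelianVariety.hasExteriorCohomologyH1_complexPoints A
  haveI := finite_complexBetti_abelianVariety T 1
  -- the virtual homomorphism on `H¹`
  let L : complexBetti T.X 1 →ₗ[ℂ] complexBetti A.X 1 :=
    (complexBetti.map q₁.hom.hom.hom 1).hom + c • (complexBetti.map q₂.hom.hom.hom 1).hom
  have hL : ∀ v, L v = complexBetti.map q₁.hom.hom.hom 1 v + c • complexBetti.map q₂.hom.hom.hom 1 v :=
    fun v => rfl
  have hLinj : Function.Injective L := by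
    rw [injective_iff_map_eq_zero]
    intro v hv
    exact hinj v (by rwa [hL] at hv)
  -- `⋀^{2g} L (θ^g) = Ω^g`
  have hpow : exteriorPullback hΛT L (2 * g) (cupPowTwo θ g) = cupPowTwo (weilGenerator q₁ q₂ d c θ) g := by
    rw [exteriorPullback_cupPowTwo, exteriorPullback_two_eq_weilGenerator q₁ q₂ hc hL]
  refine ⟨?_, ?_⟩
  · -- membership: `θ^g = a • (e₀ ⌣ ⋯ ⌣ e_{2g-1})` for a basis `e`, and the `L eᵢ` are `c`-eigenvectors
    have hb₁ : Module.finrank ℂ (complexBetti T.X 1) = 2 * g := by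
      rw [AbelianVariety.finrank_complexBetti_one, hT]
    let e : Module.Basis (Fin (2 * g)) ℂ (complexBetti T.X 1) := Module.finBasisOfFinrankEq ℂ _ hb₁
    have he0 : cupPowOne ℂ (Motives.ComplexPoints T.X) (2 * g) e ≠ 0 := cupPowOne_basis_ne_zero hΛT e
    obtain ⟨a, ha⟩ := exists_smul_eq_of_degree_top hT he0 (cupPowTwo θ g)
    rw [← hpow, ← ha, map_smul, exteriorPullback_cupPowOne]
    refine Submodule.smul_mem _ a ?_
    have hmem := cupPowOne_mem_pullbackEigenclasses (A := A) (φ := Φ) (lam := fun _ => c)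
      (v := fun i => L (e i)) (fun i => by
        rw [hL]; exact map_add_smul_map_mem_eigenspace_of_intertwining h₂ h₁ hc (e i))
    have eχ : (fun x y : ℕ => ∏ _i : Fin (2 * g), ((x : ℂ) + (y : ℂ) * c)) =
        fun x y : ℕ => ((x : ℂ) + (y : ℂ) * c) ^ (2 * g) := by
      funext x y
      rw [Finset.prod_const, Finset.card_univ, Fintype.card_fin]
    rw [← eχ]
    exact hmem
  · -- non-vanishing: `⋀^{2g} L` is injective
    rw [← hpow]
    exact fun h0 => hθ (exteriorPullback_injective hΛT hΛA hLinj (2 * g) (by rw [h0, map_zero]))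

/-- **`E₊ = ℂ · Ω₊^g`** (`c = i√d`): under the hypotheses of `cupPowTwo_weilGenerator_mem_and_ne_zero`, the `+`-Weil line
`weilClassesPlus A Φ g d` is spanned by `Ω_{i√d}(θ)^{⌣g}` for every `θ` with `θ^g ≠ 0`.
[cite: Deligne1982HodgeCycles, §4 Lemma 4.5 and Remark 4.10] [cite: vanGeemen1994HodgeAV, 4.9 and proof of Thm. 6.12] -/
theorem weilClassesPlus_eq_span_cupPowTwo_weilGenerator (hg : 0 < g) (hT : T.dim = g) (hA : A.dim = 2 * g)
    (hd : 0 < d) (hΦ : Φ ≫ Φ = -(d • 𝟙 A)) (h₂ : Φ ≫ q₂ = q₁) (h₁ : Φ ≫ q₁ = -(d • q₂))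
    (hinj : ∀ v : complexBetti T.X 1,
      complexBetti.map q₁.hom.hom.hom 1 v + (Complex.I * (Real.sqrt d : ℂ)) • complexBetti.map q₂.hom.hom.hom 1 v = 0 →
        v = 0)
    {θ : complexBetti T.X 2} (hθ : cupPowTwo θ g ≠ 0) :
    weilClassesPlus A Φ g d = ℂ ∙ cupPowTwo (weilGenerator q₁ q₂ d (Complex.I * (Real.sqrt d : ℂ)) θ) g := by
  have _ := hg
  have hc : (Complex.I * (Real.sqrt d : ℂ)) * (Complex.I * (Real.sqrt d : ℂ)) = -(d : ℂ) := by
    rw [← pow_two, I_mul_sqrt_sq]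
  obtain ⟨hmem, hne⟩ := cupPowTwo_weilGenerator_mem_and_ne_zero hT h₂ h₁ hc hinj hθ
  have eχ : (fun x y : ℕ => ((x : ℂ) + (y : ℂ) * (Complex.I * (Real.sqrt d : ℂ))) ^ (2 * g)) =
      fun x y : ℕ => ((x : ℂ) + (y : ℂ) * Complex.I * (Real.sqrt d : ℂ)) ^ (2 * g) := by
    funext x y; rw [mul_assoc]
  rw [eχ] at hmem
  have hmem' : cupPowTwo (weilGenerator q₁ q₂ d (Complex.I * (Real.sqrt d : ℂ)) θ) g ∈ weilClassesPlus A Φ g d := hmem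
  have hb₁A : Module.finrank ℂ (complexBetti A.X 1) = 2 * (2 * g) := by
    rw [AbelianVariety.finrank_complexBetti_one, hA]
  refine le_antisymm
    (weilClassesPlus_le_span_singleton (AbelianVariety.hasExteriorCohomologyH1_complexPoints A) hb₁A hd hΦ hmem' hne) ?_
  rw [Submodule.span_singleton_le_iff_mem]
  exact hmem'

/-- **`E₋ = ℂ · Ω₋^g`** (`c = -i√d`). [cite: Deligne1982HodgeCycles, §4 Lemma 4.5 and Remark 4.10]
[cite: vanGeemen1994HodgeAV, 4.9 and proof of Thm. 6.12] -/
theorem weilClassesMinus_eq_span_cupPowTwo_weilGenerator (hg : 0 < g) (hT : T.dim = g) (hA : A.dim = 2 * g)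
    (hd : 0 < d) (hΦ : Φ ≫ Φ = -(d • 𝟙 A)) (h₂ : Φ ≫ q₂ = q₁) (h₁ : Φ ≫ q₁ = -(d • q₂))
    (hinj : ∀ v : complexBetti T.X 1,
      complexBetti.map q₁.hom.hom.hom 1 v + (-(Complex.I * (Real.sqrt d : ℂ))) • complexBetti.map q₂.hom.hom.hom 1 v = 0 →
        v = 0)
    {θ : complexBetti T.X 2} (hθ : cupPowTwo θ g ≠ 0) :
    weilClassesMinus A Φ g d = ℂ ∙ cupPowTwo (weilGenerator q₁ q₂ d (-(Complex.I * (Real.sqrt d : ℂ))) θ) g := by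
  have _ := hg
  have hc : (-(Complex.I * (Real.sqrt d : ℂ))) * (-(Complex.I * (Real.sqrt d : ℂ))) = -(d : ℂ) := by
    rw [neg_mul_neg, ← pow_two, I_mul_sqrt_sq]
  obtain ⟨hmem, hne⟩ := cupPowTwo_weilGenerator_mem_and_ne_zero hT h₂ h₁ hc hinj hθ
  have eχ : (fun x y : ℕ => ((x : ℂ) + (y : ℂ) * (-(Complex.I * (Real.sqrt d : ℂ)))) ^ (2 * g)) =
      fun x y : ℕ => ((x : ℂ) - (y : ℂ) * Complex.I * (Real.sqrt d : ℂ)) ^ (2 * g) := by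
    funext x y; rw [mul_neg, ← sub_eq_add_neg, mul_assoc]
  rw [eχ] at hmem
  have hmem' : cupPowTwo (weilGenerator q₁ q₂ d (-(Complex.I * (Real.sqrt d : ℂ))) θ) g ∈ weilClassesMinus A Φ g d :=
    hmem
  have hb₁A : Module.finrank ℂ (complexBetti A.X 1) = 2 * (2 * g) := by
    rw [AbelianVariety.finrank_complexBetti_one, hA]
  refine le_antisymm
    (weilClassesMinus_le_span_singleton (AbelianVariety.hasExteriorCohomologyH1_complexPoints A) hb₁A hd hΦ hmem' hne) ?_
  rw [Submodule.span_singleton_le_iff_mem]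
  exact hmem'

/-- **`W_K ⊗ ℂ = span {Ω₊^g, Ω₋^g}`**: the Weil plane `weilClassesOf A Φ g d = E₊ ⊔ E₋` is spanned by the two `g`-th powers
`Ω_{±i√d}(θ)^{⌣g}`, for every `θ ∈ H²(T)` with `θ^g ≠ 0`. [cite: Deligne1982HodgeCycles, §4 Lemma 4.5 and Remark 4.10]
[cite: vanGeemen1994HodgeAV, 4.9] -/
theorem weilClassesOf_eq_span_cupPowTwo_weilGenerator (hg : 0 < g) (hT : T.dim = g) (hA : A.dim = 2 * g)
    (hd : 0 < d) (hΦ : Φ ≫ Φ = -(d • 𝟙 A)) (h₂ : Φ ≫ q₂ = q₁) (h₁ : Φ ≫ q₁ = -(d • q₂))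
    (hinj : ∀ (c : ℂ) (v : complexBetti T.X 1), c * c = -(d : ℂ) →
      complexBetti.map q₁.hom.hom.hom 1 v + c • complexBetti.map q₂.hom.hom.hom 1 v = 0 → v = 0)
    {θ : complexBetti T.X 2} (hθ : cupPowTwo θ g ≠ 0) :
    weilClassesOf A Φ g d =
      Submodule.span ℂ {cupPowTwo (weilGenerator q₁ q₂ d (Complex.I * (Real.sqrt d : ℂ)) θ) g,
        cupPowTwo (weilGenerator q₁ q₂ d (-(Complex.I * (Real.sqrt d : ℂ))) θ) g} := by
  have hc : (Complex.I * (Real.sqrt d : ℂ)) * (Complex.I * (Real.sqrt d : ℂ)) = -(d : ℂ) := by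
    rw [← pow_two, I_mul_sqrt_sq]
  have hc' : (-(Complex.I * (Real.sqrt d : ℂ))) * (-(Complex.I * (Real.sqrt d : ℂ))) = -(d : ℂ) := by
    rw [neg_mul_neg, ← pow_two, I_mul_sqrt_sq]
  rw [weilClassesOf, weilClassesPlus_eq_span_cupPowTwo_weilGenerator hg hT hA hd hΦ h₂ h₁ (fun v => hinj _ v hc) hθ,
    weilClassesMinus_eq_span_cupPowTwo_weilGenerator hg hT hA hd hΦ h₂ h₁ (fun v => hinj _ v hc') hθ,
    Submodule.span_insert]

end Abstract

/-! ### Non-exceptionality: `W_K ⊗ ℂ ⊆ Dᵍ ⊗ ℂ` at the squares -/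

section DivisorSpan

variable {N : ℕ}

/-- A cup product of a class in `Dᵐ ⊗ ℂ` with a class in `D¹ ⊗ ℂ = span_ℂ {rational (1,1)-classes}` lies in `D^{m+1} ⊗ ℂ`
(bilinearity and the recursion defining `divisorMonomials`). [cite: vanGeemen1994HodgeAV, §2.4] -/
theorem cupProduct_mem_divisorClassesSpan_succ {X : Motives.SchemeOver ℂ} {m : ℕ} (h : 2 * m + 2 = 2 * (m + 1))
    {a : complexBetti X (2 * m)} (ha : a ∈ divisorClassesSpan X N m) {b : complexBetti X 2}
    (hb : b ∈ Submodule.span ℂ {b : complexBetti X 2 | IsRationalClass b ∧ IsOfHodgeType N X 2 1 1 b}) :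
    cupProduct h a b ∈ divisorClassesSpan X N (m + 1) := by
  -- for a generator `b`, the map `a ↦ a ⌣ b` sends `Dᵐ ⊗ ℂ` into `D^{m+1} ⊗ ℂ`
  have hgen : ∀ b' : complexBetti X 2, IsRationalClass b' → IsOfHodgeType N X 2 1 1 b' →
      ∀ a' ∈ divisorClassesSpan X N m, cupProduct h a' b' ∈ divisorClassesSpan X N (m + 1) := by
    intro b' hb' hb'' a' ha'
    have : divisorClassesSpan X N m ≤ (divisorClassesSpan X N (m + 1)).comap ((cupProduct h).flip b') := by
      refine Submodule.span_le.2 fun a₀ ha₀ => ?_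
      exact Submodule.subset_span (mem_divisorMonomials_succ.2 ⟨a₀, ha₀, b', hb', hb'', rfl⟩)
    exact this ha'
  -- then extend linearly in `b`
  have : Submodule.span ℂ {b : complexBetti X 2 | IsRationalClass b ∧ IsOfHodgeType N X 2 1 1 b} ≤
      (divisorClassesSpan X N (m + 1)).comap (cupProduct h a) :=
    Submodule.span_le.2 fun b₀ hb₀ => hgen b₀ hb₀.1 hb₀.2 a ha
  exact this hb

/-- **Powers of a class of `D¹ ⊗ ℂ` lie in `Dⁱ ⊗ ℂ`**: if `x ∈ span_ℂ {rational (1,1)-classes}` then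
`xⁱ ∈ divisorClassesSpan X N i`. [cite: vanGeemen1994HodgeAV, §2.4] -/
theorem cupPowTwo_mem_divisorClassesSpan {X : Motives.SchemeOver ℂ} {x : complexBetti X 2}
    (hx : x ∈ Submodule.span ℂ {b : complexBetti X 2 | IsRationalClass b ∧ IsOfHodgeType N X 2 1 1 b}) :
    ∀ i : ℕ, cupPowTwo x i ∈ divisorClassesSpan X N i
  | 0 => Submodule.subset_span (mem_divisorMonomials_zero.2 rfl)
  | i + 1 => by
    rw [cupPowTwo_succ]
    exact cupProduct_mem_divisorClassesSpan_succ _ (cupPowTwo_mem_divisorClassesSpan hx i) hx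

variable {g d : ℕ} {Φ : A ⟶ A} {q₁ q₂ : A ⟶ T}

/-- **The Weil generator of a restricted rational `(1,1)`-class lies in `D¹ ⊗ ℂ`.** If `Θ ∈ H²(A(ℂ); ℂ)` is a rational class
of Hodge type `(1,1)` (`A` smooth projective of dimension `2g`) and `θ = s^*Θ` for a homomorphism `s : T ⟶ A`, then
`Ω_c(θ) = (q₁ ≫ s)^*Θ - d·(q₂ ≫ s)^*Θ + c·(((q₁+q₂) ≫ s)^*Θ - …)` is a `ℂ`-combination of pull-backs of `Θ` along
ENDOMORPHISMS of `A`, which are rational `(1,1)`-classes (`isRationalClass_map`, `IsOfHodgeType.map_endomorphism`).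
[cite: VoisinHodgeI2002, §7.3.2] [cite: vanGeemen1994HodgeAV, §2.4] -/
theorem weilGenerator_mem_span_rational_oneOne (hA : A.dim = 2 * g) (s : T ⟶ A) {Θ : complexBetti A.X 2}
    (hΘ : IsRationalClass Θ) (hΘ11 : IsOfHodgeType (2 * g) A.X 2 1 1 Θ) (c : ℂ) :
    weilGenerator q₁ q₂ d c (complexBetti.map s.hom.hom.hom 2 Θ) ∈
      Submodule.span ℂ {b : complexBetti A.X 2 | IsRationalClass b ∧ IsOfHodgeType (2 * g) A.X 2 1 1 b} := by
  have hX : IsSmoothProjective (2 * g) A.X := Motives.isSmoothProjective_of_dim_eq' hA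
  have hend : ∀ u : A ⟶ A, complexBetti.map u.hom.hom.hom 2 Θ ∈
      Submodule.span ℂ {b : complexBetti A.X 2 | IsRationalClass b ∧ IsOfHodgeType (2 * g) A.X 2 1 1 b} :=
    fun u => Submodule.subset_span ⟨hΘ.pullback _, hΘ11.map_endomorphism hX u.hom.hom.hom⟩
  rw [weilGenerator, complexBetti_map_map_hom, complexBetti_map_map_hom, complexBetti_map_map_hom]
  refine Submodule.add_mem _ (Submodule.sub_mem _ (hend _) (Submodule.smul_mem _ _ (hend _)))
    (Submodule.smul_mem _ _ (Submodule.sub_mem _ (Submodule.sub_mem _ (hend _) (hend _)) (hend _)))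

/-- **Non-exceptionality at an intertwined square: `W_K ⊗ ℂ ⊆ Dᵍ ⊗ ℂ`.** Under the hypotheses of the abstract square
theorem, if `A` carries a rational `(1,1)`-class `Θ` (e.g. a polarization) whose restriction `s^*Θ` along some
`s : T ⟶ A` has non-zero top power, then `weilClassesOf A Φ g d ≤ divisorClassesSpan A (2g) g`: the Weil classes of
`(A, Φ)` are polynomials in divisor classes — in contrast with the GENERAL Weil-type abelian variety, where they are not
(Weil 1977 = van Geemen Thm. 4.11, barrier `Weil1977_exceptionalHodgeClasses`). [cite: vanGeemen1994HodgeAV, §2.4 and Thm. 4.11]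
[cite: Deligne1982HodgeCycles, §4 Remark 4.10] -/
theorem weilClassesOf_le_divisorClassesSpan_of_intertwining (hg : 0 < g) (hT : T.dim = g) (hA : A.dim = 2 * g)
    (hd : 0 < d) (hΦ : Φ ≫ Φ = -(d • 𝟙 A)) (h₂ : Φ ≫ q₂ = q₁) (h₁ : Φ ≫ q₁ = -(d • q₂))
    (hinj : ∀ (c : ℂ) (v : complexBetti T.X 1), c * c = -(d : ℂ) →
      complexBetti.map q₁.hom.hom.hom 1 v + c • complexBetti.map q₂.hom.hom.hom 1 v = 0 → v = 0)
    (s : T ⟶ A) {Θ : complexBetti A.X 2} (hΘ : IsRationalClass Θ) (hΘ11 : IsOfHodgeType (2 * g) A.X 2 1 1 Θ)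
    (hθ : cupPowTwo (complexBetti.map s.hom.hom.hom 2 Θ) g ≠ 0) :
    weilClassesOf A Φ g d ≤ divisorClassesSpan A.X (2 * g) g := by
  rw [weilClassesOf_eq_span_cupPowTwo_weilGenerator hg hT hA hd hΦ h₂ h₁ hinj hθ, Submodule.span_le]
  rintro w hw
  rcases hw with rfl | rfl <;>
    exact cupPowTwo_mem_divisorClassesSpan (weilGenerator_mem_span_rational_oneOne hA s hΘ hΘ11 _) g

end DivisorSpan


end HodgeTheory

end Literature.AlgebraicGeometry.HodgeTheory

end
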